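import Literature.Probability.Percolation.TwoAvoidanceSets
import Literature.Probability.Percolation.TwoClusterConditionalAssociationProofs
import HarnessLib

/-!
# `NoHeavyLowerTail` (stmt-CriticalPhenomena-4575) — conditioning on one cluster: the general domain Markov identity

Support file (prover `prim-lf-1`, lemma factory #1; `--supports stmt-CriticalPhenomena-4575`).  No definitions,
no named facts, no sorries.  Used by `…CoreRepulsionSep.lean` (random-core row (β)).

`Literature.….BHK2006.sum_cond_cluster` records van den Berg–Häggström–Kahn's display (10) for a function of
`(C_s, C_t)`: conditioning on the edge cluster `C_s = W`, the cluster of ONE further vertex `t ∉ V(W)` is computed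
in fresh variables off `W̄`.  The random-core rows need the same identity for events involving SEVERAL further
clusters (`{o ↔ b}` and "the core is connected" read off `C_b` and `C_c` simultaneously), so this file states the
identity in its natural generality (`sum_cond_cluster_off`): for ANY function `K` of `W = C_s` and of the
configuration off `W̄`, `E[K(C_s, ω ∖ W̄(C_s))] = Σ_ω weight(ω) Σ_η weight(η) K(C_s ω, η ∖ W̄(C_s ω))` — the
configuration off `W̄` is independent of `{C_s = W}` (block Fubini on the cylinder event `{C_s = W}`,
`BHK2006.openEdgeCluster_inter_bar_eq_iff`).  Users combine it with `BHK2006.openEdgeCluster_eq_sdiff_bar`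
(on `{s ↮ t}`, `C_t(ω) = C_t(ω ∖ W̄)`), once per further vertex.
-/

noncomputable section

namespace Summit.CriticalPhenomena.PercolationContinuityZ3.Theorems

open MeasureTheory Set Literature.Probability.LatticeModels Literature.Probability.Percolation
open BHK2006 DecisionTree TwoAvoidanceSets
open scoped Classical BigOperators

namespace CoreConditioning

variable {V : Type*} [Fintype V]

/-- **The configuration off `W̄` is independent of `{C_s = W}`** (general form of BHK's display (10) with the
domain Markov property): for any function `K` of the edge cluster `W = C_s` and of the configuration off
`W̄ = {e | ∃ v ∈ e, v = s ∨ ∃ e' ∈ W, v ∈ e'}`,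
`E[K(C_s, ω ∖ W̄(C_s))] = Σ_ω weight(ω) Σ_η weight(η) K(C_s ω, η ∖ W̄(C_s ω))`.
[cite: VandenbergHaggstromKahn2005, §1 pp. 7–8, display (10) and the paragraph following it] -/
theorem sum_cond_cluster_off (w : Sym2 V → ℝ) (hm : ∑ ω, weight w ω = 1) (s : V)
    (K : Set (Sym2 V) → Set (Sym2 V) → ℝ) :
    ∑ ω, weight w ω * K (openEdgeCluster ω s)
        (ω \ {e | ∃ v ∈ e, v = s ∨ ∃ e' ∈ openEdgeCluster ω s, v ∈ e'}) =
      ∑ ω, weight w ω * ∑ η, weight w η * K (openEdgeCluster ω s)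
        (η \ {e | ∃ v ∈ e, v = s ∨ ∃ e' ∈ openEdgeCluster ω s, v ∈ e'}) := by
  -- the identity on each event `{C_s = W}`
  have key : ∀ W : Set (Sym2 V),
      ∑ ω, (if openEdgeCluster ω s = W then
          weight w ω * K W (ω \ {e | ∃ v ∈ e, v = s ∨ ∃ e' ∈ W, v ∈ e'}) else 0) =
      ∑ ω, (if openEdgeCluster ω s = W then
          weight w ω * ∑ η, weight w η * K W (η \ {e | ∃ v ∈ e, v = s ∨ ∃ e' ∈ W, v ∈ e'}) else 0) := by
    intro W
    set A : Set (Sym2 V) := {e | ∃ v ∈ e, v = s ∨ ∃ e' ∈ W, v ∈ e'} with hA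
    set Φ : Set (Sym2 V) → Set (Sym2 V) → ℝ := fun ζ θ =>
      if openEdgeCluster ζ s = W then K W (θ \ A) else 0 with hΦ
    have h1 : ∀ ω, (if openEdgeCluster ω s = W then weight w ω * K W (ω \ A) else 0) =
        weight w ω * Φ (ω ∩ A) (ω \ A) := by
      intro ω
      simp only [hΦ, hA, openEdgeCluster_inter_bar_eq_iff]
      rw [← hA, sdiff_idem]
      split_ifs <;> simp
    have h2 : ∀ ω, weight w ω * ∑ ω', weight w ω' * Φ (ω ∩ A) (ω' \ A) =
        (if openEdgeCluster ω s = W then weight w ω * ∑ η, weight w η * K W (η \ A) else 0) := by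
      intro ω
      simp only [hΦ, hA, openEdgeCluster_inter_bar_eq_iff]
      rw [← hA]
      split_ifs
      · simp only [sdiff_idem]
      · simp
    calc ∑ ω, (if openEdgeCluster ω s = W then weight w ω * K W (ω \ A) else 0)
        = (∑ ω, weight w ω) * ∑ ω, weight w ω * Φ (ω ∩ A) (ω \ A) := by
          rw [hm, one_mul]; exact Finset.sum_congr rfl fun ω _ => h1 ω
      _ = ∑ ω, weight w ω * ∑ ω', weight w ω' * Φ (ω ∩ A) (ω' \ A) := blockFubini w A Φ
      _ = _ := Finset.sum_congr rfl fun ω _ => h2 ω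
  -- sum over `W`
  calc ∑ ω, weight w ω * K (openEdgeCluster ω s)
        (ω \ {e | ∃ v ∈ e, v = s ∨ ∃ e' ∈ openEdgeCluster ω s, v ∈ e'})
      = ∑ ω, ∑ W, (if openEdgeCluster ω s = W then
          weight w ω * K W (ω \ {e | ∃ v ∈ e, v = s ∨ ∃ e' ∈ W, v ∈ e'}) else 0) := by
        refine Finset.sum_congr rfl fun ω _ => ?_
        rw [Fintype.sum_ite_eq (openEdgeCluster ω s)]
    _ = ∑ W, ∑ ω, (if openEdgeCluster ω s = W then
          weight w ω * K W (ω \ {e | ∃ v ∈ e, v = s ∨ ∃ e' ∈ W, v ∈ e'}) else 0) := Finset.sum_comm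
    _ = ∑ W, ∑ ω, (if openEdgeCluster ω s = W then
          weight w ω * ∑ η, weight w η * K W (η \ {e | ∃ v ∈ e, v = s ∨ ∃ e' ∈ W, v ∈ e'}) else 0) :=
        Finset.sum_congr rfl fun W _ => key W
    _ = ∑ ω, ∑ W, (if openEdgeCluster ω s = W then
          weight w ω * ∑ η, weight w η * K W (η \ {e | ∃ v ∈ e, v = s ∨ ∃ e' ∈ W, v ∈ e'}) else 0) :=
        Finset.sum_comm
    _ = _ := by
        refine Finset.sum_congr rfl fun ω _ => ?_
        rw [Fintype.sum_ite_eq (openEdgeCluster ω s)]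

end CoreConditioning

end Summit.CriticalPhenomena.PercolationContinuityZ3.Theorems

end
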